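import Literature.MathematicalPhysics.QuantumLattice.KomaPiFluxBCSModel
import HarnessLib

/-!
# Gaussian domination for Koma's `π`-flux BCS lattice-fermion model (Koma 2022, Theorem 5.3)

T. Koma, *Nambu–Goldstone modes for superconducting lattice fermions*, arXiv:2201.13135 (2022)
[Koma2022], §4 and Theorem 5.3. The reflection-positivity inequality of Cor. 5.2 / (5.99) —
`Z(h)² ≤ Z(h_LL) Z(h_RR)` for the ONE cutting plane `P ⊥ e₀` of Lieb's frame, proved in
`KomaPiFluxBCSModel.lean` (`KomaPiFlux.partitionFn_sq_le`) — is turned into the **Gaussian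
domination bound** (5.100),

  `Tr exp[-βH(B, h)] ≤ Tr exp[-βH(B, 0)]` for every real field `h` on the (ordered) bonds,

exactly as printed: "as shown in Sec. 4.1, we can change the locations of the bonds with the
opposite sign of the hopping amplitudes due to the anti-periodic boundary conditions by using a
gauge transformation. Further, as shown in Sec. 4.2, we can also interchange the roles of the
hopping amplitudes in the `x^{(1)}` and `x^{(j)}` directions … Combining these observations with the
argument in the proof of Theorem 4.2 in [DLS1978], we obtain [Theorem 5.3]" [Koma2022, p. 21].

## Contents (everything PROVED; no named facts)

* Covariance of the pair-hopping Hamiltonian `PairHopRP.hamiltonian G T U g h B` (generic graph):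
  under site relabellings `relabel (Orb.mapEquiv f)` along a graph isomorphism
  (`PairHopRP.relabel_hamiltonian`: `T ↦ T ∘ f⁻¹`, `h ↦ h ∘ f⁻¹`; the tree's
  `relabel_peierlsHubbard` plus `Γ_x ↦ Γ_{f x}`), and under gauge transformations `orbitalPhaseAut`
  with `g_↑(x) g_↓(x) = 1` — in particular the `ℤ₂` gauges `a_{x,σ} ↦ ε(x) a_{x,σ}`, `ε = ±1`, of
  [Koma2022, (4.1), (4.5)] — which fix every `Γ^{±}_x` and multiply `t_{xy}` by `ε(x)ε(y)`
  (`PairHopRP.orbitalPhaseAut_hamiltonian`); invariance of the partition function under both.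
* The symmetries of the `π`-flux amplitudes `T_π` of Lieb's frame (`KomaPiFlux.piFluxAmpl`): the
  unit translation along the cut direction (Koma's §4.1: the antiperiodic seam is moved by the gauge
  `ε(x) = (-1)^{x₁+⋯+x_d} u(x₀)`, `KomaPiFlux.translateGauge`) and the cyclic rotation of the
  coordinate axes (Koma's §4.2, `U_HA(i,j) = ∏_{x_i, x_j odd} e^{iπn_x}`: the gauge
  `ε(x) = (-1)^{x₀(x₁+⋯+x_d)}`, `KomaPiFlux.rotateGauge`) map `T_π` to `ε T_π ε`
  (`piFluxAmpl_translate`, `piFluxAmpl_rotateAxes`); hence `Z(h ∘ f) = Z(h)` for both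
  (`partitionFn_translate`, `partitionFn_rotateAxes`) and for the group they generate, which moves
  every bond onto a bond through the plane `P` (`exists_symmetry_to_cut`).
* `gaussianDomination_descent` — the argument of [DLS1978, proof of Thm. 4.2] for BOND fields on
  the fermionic torus, once, for an arbitrary real function `E` of the field: reflection inequality
  at `P` + invariance under a bond-transitive family of graph automorphisms + `E` blind to the field
  off the bonds ⟹ `E(0) ≤ E(h)`. (The tree's `gaussianDomination_descent` of
  `AnisotropicHeisenbergGaussianDomination.lean` is the SITE-field version with all planes given;
  here one plane and the symmetry group replace the family of planes, as in Koma's text.)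
* **`KomaPiFlux.partitionFn_le`** — Theorem 5.3 (5.100) in Lieb's frame: on the even torus
  `(ℤ/Lℤ)^{d+1}`, `L ≥ 4`, for `κ ≥ 0`, `g ≥ 0`, `β > 0`, any `U`, `B` and any real `h`,
  `Z_β(T_π; U, g, h; B) ≤ Z_β(T_π; U, g, 0; B)`; and its ground-state form
  **`KomaPiFlux.groundEnergy_le`**: `E₀(h = 0) ≤ E₀(h)`.

WHAT THIS IS NOT: no infrared bound and no long-range order (Koma §6, Thm. 2.1) — sequel; the
model is Koma's in Lieb's reflection frame (`KomaPiFluxBCSModel.lean`, module docstring: Koma's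
printed Hamiltonian is the case `U = -2g(d+1)` up to a constant, an `η`-rotation and a gauge).

## References

* [Koma2022] T. Koma, arXiv:2201.13135, §4.1 (4.1)–(4.4), §4.2 (4.5)–(4.9), Cor. 5.2 (5.99),
  Thm. 5.3 (5.100) and the paragraph before it (p. 21).
* [DLS1978] F. J. Dyson, E. H. Lieb, B. Simon, J. Stat. Phys. 18 (1978) 335, Thm. 4.2 (proof).
* [Lieb1994] E. H. Lieb, Phys. Rev. Lett. 73 (1994) 2158, p. 3 (gauge transformations).
-/

noncomputable section

namespace Literature.MathematicalPhysics.QuantumLattice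

open Matrix Finset HubbardWave0 NormedSpace PairHopRP LiebCutRP PairHopCutRP
open FermionTorus.Cut
open FermionTorus (shift unshift shift_unshift unshift_shift shift_injective shift_ne_unshift
  adj_iff_shift_or_unshift shiftEquiv shiftEquiv_apply ofLex_shift toTorusSite_shift toTorusSite_injective)

/-! ### Covariance of the pair-hopping Hamiltonian (generic graph) -/

namespace PairHopRP

section Relabel

variable {Λ Λ' : Type*} [LinearOrder Λ] [Fintype Λ] [LinearOrder Λ'] [Fintype Λ']
  (G : SimpleGraph Λ) [DecidableRel G.Adj] (G' : SimpleGraph Λ') [DecidableRel G'.Adj]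

/-- `Γ⁺_x ↦ Γ⁺_{f x}` under the relabelling. [cite: Koma2022, (4.2) (lattice shifts of `Γ`)] -/
theorem relabel_gammaPlus (f : Λ ≃ Λ') (x : Λ) :
    relabel (Orb.mapEquiv f) (gammaPlus x) = gammaPlus (f x) := by
  rw [gammaPlus, gammaPlus, map_mul, relabel_creation, relabel_creation, Orb.mapEquiv_orb,
    Orb.mapEquiv_orb]

/-- `Γ⁻_x ↦ Γ⁻_{f x}` under the relabelling. [cite: Koma2022, (4.2)] -/
theorem relabel_gammaMinus (f : Λ ≃ Λ') (x : Λ) :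
    relabel (Orb.mapEquiv f) (gammaMinus x) = gammaMinus (f x) := by
  rw [gammaMinus, gammaMinus, map_mul, relabel_annihilation, relabel_annihilation, Orb.mapEquiv_orb,
    Orb.mapEquiv_orb]

/-- `Γ¹_x ↦ Γ¹_{f x}` under the relabelling. [cite: Koma2022, (4.2)] -/
theorem relabel_gammaOne (f : Λ ≃ Λ') (x : Λ) :
    relabel (Orb.mapEquiv f) (gammaOne x) = gammaOne (f x) := by
  rw [gammaOne, gammaOne, map_add, relabel_gammaPlus, relabel_gammaMinus]

/-- `Γ²_x ↦ Γ²_{f x}` under the relabelling. [cite: Koma2022, (4.2)] -/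
theorem relabel_gammaTwo (f : Λ ≃ Λ') (x : Λ) :
    relabel (Orb.mapEquiv f) (gammaTwo x) = gammaTwo (f x) := by
  rw [gammaTwo, gammaTwo, map_smul, map_sub, relabel_gammaPlus, relabel_gammaMinus]

/-- The bond operator is relabelled bondwise. [cite: Koma2022, (4.2)] -/
theorem relabel_bondTerm (f : Λ ≃ Λ') (g φ : ℝ) (x y : Λ) :
    relabel (Orb.mapEquiv f) (bondTerm g φ x y) = bondTerm g φ (f x) (f y) := by
  rw [bondTerm, bondTerm, map_smul, map_add, map_mul, map_mul, map_add, map_sub, map_sub, map_smul,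
    map_one, relabel_gammaOne, relabel_gammaOne, relabel_gammaTwo, relabel_gammaTwo]

/-- **Covariance of the pair interaction under graph isomorphisms**: the field is transported,
`h' x' y' = h (f⁻¹ x') (f⁻¹ y')`. [cite: Koma2022, §4.1 (4.2)–(4.4)] -/
theorem relabel_pairInteraction (f : Λ ≃ Λ') (hG : ∀ x y, G'.Adj (f x) (f y) ↔ G.Adj x y) (g : ℝ)
    (h : Λ → Λ → ℝ) :
    relabel (Orb.mapEquiv f) (pairInteraction G g h) =
      pairInteraction G' g (fun x' y' => h (f.symm x') (f.symm y')) := by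
  rw [pairInteraction, pairInteraction, map_sum, ← f.sum_comp]
  refine Finset.sum_congr rfl fun x _ => ?_
  rw [map_sum, ← f.sum_comp]
  refine Finset.sum_congr rfl fun y _ => ?_
  by_cases hadj : G.Adj x y
  · rw [if_pos hadj, if_pos ((hG x y).2 hadj), relabel_bondTerm, Equiv.symm_apply_apply,
      Equiv.symm_apply_apply]
  · rw [if_neg hadj, if_neg (fun h' => hadj ((hG x y).1 h')), map_zero]

/-- **Covariance of the pair-hopping Hamiltonian under graph isomorphisms**:
`Γ(f) H(T, h) Γ(f)⁻¹ = H(T ∘ f⁻¹, h ∘ f⁻¹)`. [cite: Koma2022, §4.1 (4.2)–(4.4)] -/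
theorem relabel_hamiltonian (f : Λ ≃ Λ') (hG : ∀ x y, G'.Adj (f x) (f y) ↔ G.Adj x y)
    (T : Fin 2 → Λ → Λ → ℂ) (U g : ℝ) (h : Λ → Λ → ℝ) (B : ℝ) :
    relabel (Orb.mapEquiv f) (hamiltonian G T U g h B) =
      hamiltonian G' (fun σ x' y' => T σ (f.symm x') (f.symm y')) U g
        (fun x' y' => h (f.symm x') (f.symm y')) B := by
  -- the order parameter `Σ_x Γ²_x` is relabelling invariant [Koma2022, (4.3)]
  have hO : relabel (Orb.mapEquiv f) (orderParameter : Matrix (Finset (Orb Λ)) (Finset (Orb Λ)) ℂ) =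
      orderParameter := by
    rw [orderParameter, orderParameter, map_sum, ← f.sum_comp]
    exact Finset.sum_congr rfl fun x _ => relabel_gammaTwo f x
  rw [hamiltonian, hamiltonian, map_sub, map_add, map_smul, relabel_peierlsHubbard G G' f hG,
    relabel_pairInteraction G G' f hG, hO]

/-- **Invariance of the partition function under graph isomorphisms.** [cite: Koma2022, (4.3)–(4.4)] -/
theorem partitionFn_hamiltonian_relabel (f : Λ ≃ Λ') (hG : ∀ x y, G'.Adj (f x) (f y) ↔ G.Adj x y)
    (T : Fin 2 → Λ → Λ → ℂ) (U g : ℝ) (h : Λ → Λ → ℝ) (B β : ℝ) :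
    (hamiltonian G' (fun σ x' y' => T σ (f.symm x') (f.symm y')) U g
        (fun x' y' => h (f.symm x') (f.symm y')) B).partitionFn β =
      (hamiltonian G T U g h B).partitionFn β := by
  rw [← relabel_hamiltonian G G' f hG, partitionFn_relabel]

end Relabel

section Gauge

variable {Λ : Type*} [LinearOrder Λ] [Fintype Λ] (G : SimpleGraph Λ) [DecidableRel G.Adj]

/-- `D Γ⁺_x Dᴴ = g_↑(x) g_↓(x) Γ⁺_x`. [cite: Koma2022, §4.1 ("does not change `Γ`")] [cite: Lieb1994, p. 3] -/
theorem orbitalPhaseAut_gammaPlus (ph : Fin 2 → Λ → ℂ) (hph : ∀ σ x, ‖ph σ x‖ = 1) (x : Λ) :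
    orbitalPhaseAut (g := spinSitePhase ph) (fun _ => hph _ _) (gammaPlus x) =
      (ph 0 x * ph 1 x) • gammaPlus x := by
  rw [gammaPlus, map_mul, orbitalPhaseAut_apply, orbitalPhaseAut_apply,
    orbitalPhase_conj_creation (fun _ => hph _ _), orbitalPhase_conj_creation (fun _ => hph _ _),
    Matrix.smul_mul, Matrix.mul_smul, smul_smul]
  rfl

/-- `D Γ⁻_x Dᴴ = (g_↑(x) g_↓(x))^* Γ⁻_x`. [cite: Koma2022, §4.1] [cite: Lieb1994, p. 3] -/
theorem orbitalPhaseAut_gammaMinus (ph : Fin 2 → Λ → ℂ) (hph : ∀ σ x, ‖ph σ x‖ = 1) (x : Λ) :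
    orbitalPhaseAut (g := spinSitePhase ph) (fun _ => hph _ _) (gammaMinus x) =
      star (ph 0 x * ph 1 x) • gammaMinus x := by
  rw [gammaMinus, map_mul, orbitalPhaseAut_apply, orbitalPhaseAut_apply,
    orbitalPhase_conj_annihilation (fun _ => hph _ _), orbitalPhase_conj_annihilation (fun _ => hph _ _),
    Matrix.smul_mul, Matrix.mul_smul, smul_smul, ← star_mul]
  rfl

variable {ph : Fin 2 → Λ → ℂ} (hph : ∀ σ x, ‖ph σ x‖ = 1) (hprod : ∀ x, ph 0 x * ph 1 x = 1)
include hph hprod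

/-- A gauge with `g_↑ g_↓ = 1` (e.g. a `ℤ₂` gauge `ε(x) = ±1`) fixes `Γ¹_x`. [cite: Koma2022, §4.1–4.2] -/
theorem orbitalPhaseAut_gammaOne (x : Λ) :
    orbitalPhaseAut (g := spinSitePhase ph) (fun _ => hph _ _) (gammaOne x) = gammaOne x := by
  rw [gammaOne, map_add, orbitalPhaseAut_gammaPlus, orbitalPhaseAut_gammaMinus, hprod, star_one,
    one_smul, one_smul]

/-- A gauge with `g_↑ g_↓ = 1` fixes `Γ²_x`. [cite: Koma2022, §4.1–4.2] -/
theorem orbitalPhaseAut_gammaTwo (x : Λ) :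
    orbitalPhaseAut (g := spinSitePhase ph) (fun _ => hph _ _) (gammaTwo x) = gammaTwo x := by
  rw [gammaTwo, map_smul, map_sub, orbitalPhaseAut_gammaPlus, orbitalPhaseAut_gammaMinus, hprod,
    star_one, one_smul, one_smul]

/-- A gauge with `g_↑ g_↓ = 1` fixes the pair interaction. [cite: Koma2022, §4.1–4.2] -/
theorem orbitalPhaseAut_pairInteraction (g : ℝ) (h : Λ → Λ → ℝ) :
    orbitalPhaseAut (g := spinSitePhase ph) (fun _ => hph _ _) (pairInteraction G g h) =
      pairInteraction G g h := by
  rw [pairInteraction, map_sum]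
  refine Finset.sum_congr rfl fun x _ => ?_
  rw [map_sum]
  refine Finset.sum_congr rfl fun y _ => ?_
  split_ifs
  · rw [bondTerm, map_smul, map_add, map_mul, map_mul, map_add, map_sub, map_sub, map_smul, map_one,
      orbitalPhaseAut_gammaOne hph hprod, orbitalPhaseAut_gammaOne hph hprod,
      orbitalPhaseAut_gammaTwo hph hprod, orbitalPhaseAut_gammaTwo hph hprod]
  · rw [map_zero]

/-- A gauge with `g_↑ g_↓ = 1` fixes the order parameter. [cite: Koma2022, §4.1 (4.3)] -/
theorem orbitalPhaseAut_orderParameter :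
    orbitalPhaseAut (g := spinSitePhase ph) (fun _ => hph _ _)
        (orderParameter : Matrix (Finset (Orb Λ)) (Finset (Orb Λ)) ℂ) = orderParameter := by
  rw [orderParameter, map_sum]
  exact Finset.sum_congr rfl fun x _ => orbitalPhaseAut_gammaTwo hph hprod x

/-- **Gauge covariance of the pair-hopping Hamiltonian**: a gauge with `g_↑(x) g_↓(x) = 1`
acts on the hopping only, `T ↦ (σ, x, y) ↦ g_σ(x) g_σ(y)^* T_σ(x, y)`.
[cite: Koma2022, §4.1 (4.1), §4.2 (4.5)–(4.9)] [cite: Lieb1994, p. 3] -/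
theorem orbitalPhaseAut_hamiltonian (T : Fin 2 → Λ → Λ → ℂ) (U g : ℝ) (h : Λ → Λ → ℝ) (B : ℝ) :
    orbitalPhaseAut (g := spinSitePhase ph) (fun _ => hph _ _) (hamiltonian G T U g h B) =
      hamiltonian G (fun σ x y => ph σ x * star (ph σ y) * T σ x y) U g h B := by
  rw [hamiltonian, hamiltonian, map_sub, map_add, map_smul, orbitalPhaseAut_peierlsHubbard G ph hph T U,
    orbitalPhaseAut_pairInteraction G hph hprod, orbitalPhaseAut_orderParameter hph hprod]

/-- **Gauge invariance of the partition function.** [cite: Koma2022, §4.1–4.2] [cite: Lieb1994, p. 1] -/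
theorem partitionFn_hamiltonian_gauge (T : Fin 2 → Λ → Λ → ℂ) (U g : ℝ) (h : Λ → Λ → ℝ) (B β : ℝ) :
    (hamiltonian G (fun σ x y => ph σ x * star (ph σ y) * T σ x y) U g h B).partitionFn β =
      (hamiltonian G T U g h B).partitionFn β := by
  rw [← orbitalPhaseAut_hamiltonian G hph hprod T U g h B, orbitalPhaseAut_apply,
    ← star_eq_conjTranspose]
  exact partitionFn_unitary_conj (orbitalPhase_mem_unitary fun _ => hph _ _) β _

omit hph hprod in
/-- **`ℤ₂` gauge invariance of the partition function**: for a sign function `ε = ±1` on the sites,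
`Z(ε T ε) = Z(T)` where `(ε T ε)_σ(x, y) = ε(x) ε(y) T_σ(x, y)` — the pair operators `Γ^{±}_x`
are even in the fermions at `x`, hence invariant. [cite: Koma2022, §4.1 (4.1), §4.2 (4.5)] -/
theorem partitionFn_hamiltonian_signGauge (ε : Λ → ℝ) (hε : ∀ x, ε x = 1 ∨ ε x = -1)
    (T : Fin 2 → Λ → Λ → ℂ) (U g : ℝ) (h : Λ → Λ → ℝ) (B β : ℝ) :
    (hamiltonian G (fun σ x y => ((ε x * ε y : ℝ) : ℂ) * T σ x y) U g h B).partitionFn β =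
      (hamiltonian G T U g h B).partitionFn β := by
  have hn : ∀ (σ : Fin 2) (x : Λ), ‖(fun (_ : Fin 2) (x : Λ) => (ε x : ℂ)) σ x‖ = 1 := fun σ x => by
    rcases hε x with h1 | h1 <;> simp [h1]
  have hp : ∀ x : Λ, (fun (_ : Fin 2) (x : Λ) => (ε x : ℂ)) 0 x * (fun (_ : Fin 2) (x : Λ) => (ε x : ℂ)) 1 x = 1 :=
    fun x => by rcases hε x with h1 | h1 <;> simp [h1]
  have key := partitionFn_hamiltonian_gauge G hn hp T U g h B β
  have hT : (fun σ x y => (fun (_ : Fin 2) (x : Λ) => (ε x : ℂ)) σ x *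
      star ((fun (_ : Fin 2) (x : Λ) => (ε x : ℂ)) σ y) * T σ x y) =
      fun σ x y => ((ε x * ε y : ℝ) : ℂ) * T σ x y := by
    funext σ x y
    simp only [Complex.star_def, Complex.conj_ofReal, Complex.ofReal_mul]
  rw [hT] at key
  exact key

end Gauge

end PairHopRP

/-! ### Symmetries of the `π`-flux amplitudes -/

namespace KomaPiFlux

attribute [local instance] LiebCutRP.decEqTorus

variable {d L : ℕ} [NeZero L]

section Geometry

/-- Unit shifts in different directions commute (the lattice shifts `T_m` of Koma's §4.1 commute).
[cite: Koma2022, §4.1 (4.1)–(4.2)] -/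
theorem shift_shift_comm (x : FermionTorus (d + 1) L) (μ ν : Fin (d + 1)) :
    shift (shift x μ) ν = shift (shift x ν) μ := by
  apply toTorusSite_injective
  rw [toTorusSite_shift, toTorusSite_shift, toTorusSite_shift, toTorusSite_shift, add_right_comm]

/-- **The cyclic rotation of the coordinate axes** `(f x)_k = x_{k+1}` (indices mod `d + 1`), a
graph automorphism of the torus (a product of Koma's direction interchanges of §4.2).
[cite: Koma2022, §4.2] -/
def rotateAxes : FermionTorus (d + 1) L ≃ FermionTorus (d + 1) L where
  toFun x := toLex fun k => ofLex x (finRotate (d + 1) k)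
  invFun x := toLex fun k => ofLex x ((finRotate (d + 1)).symm k)
  left_inv x := by
    refine (congrArg toLex ?_).trans (toLex_ofLex x)
    funext k
    simp only [ofLex_toLex, Equiv.apply_symm_apply]
  right_inv x := by
    refine (congrArg toLex ?_).trans (toLex_ofLex x)
    funext k
    simp only [ofLex_toLex, Equiv.symm_apply_apply]

omit [NeZero L] in
/-- Coordinates of the rotated site. [cite: Koma2022, §4.2] -/
theorem ofLex_rotateAxes (x : FermionTorus (d + 1) L) (k : Fin (d + 1)) :
    ofLex (rotateAxes x) k = ofLex x (finRotate (d + 1) k) := rfl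

/-- The axis rotation maps the shift by `e_ν` to the shift by `e_{ν-1}`. [cite: Koma2022, §4.2] -/
theorem rotateAxes_shift (x : FermionTorus (d + 1) L) (ν : Fin (d + 1)) :
    rotateAxes (shift x ν) = shift (rotateAxes x) ((finRotate (d + 1)).symm ν) := by
  refine (toLex_ofLex _).symm.trans ((congrArg toLex ?_).trans (toLex_ofLex _))
  funext k
  rw [ofLex_rotateAxes, ofLex_shift, ofLex_shift]
  by_cases hk : k = (finRotate (d + 1)).symm ν
  · subst hk
    rw [Function.update_self, Equiv.apply_symm_apply, Function.update_self, ofLex_rotateAxes,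
      Equiv.apply_symm_apply]
  · rw [Function.update_of_ne hk, Function.update_of_ne, ofLex_rotateAxes]
    intro h
    exact hk ((Equiv.eq_symm_apply _).2 h)

/-- The translation by `e₀` commutes with all shifts. [cite: Koma2022, §4.1] -/
theorem shiftEquiv_zero_shift (x : FermionTorus (d + 1) L) (ν : Fin (d + 1)) :
    shiftEquiv 0 (shift x ν) = shift (shiftEquiv 0 x) ν := by
  rw [shiftEquiv_apply, shiftEquiv_apply, shift_shift_comm]

/-- A bijection of the torus that commutes with the shifts up to a permutation of the directions
also commutes with the backward shifts. [cite: Koma2022, §4.1–4.2] -/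
theorem map_unshift_of_map_shift {f : FermionTorus (d + 1) L ≃ FermionTorus (d + 1) L}
    {π : Equiv.Perm (Fin (d + 1))} (hf : ∀ x ν, f (shift x ν) = shift (f x) (π ν))
    (x : FermionTorus (d + 1) L) (ν : Fin (d + 1)) : f (unshift x ν) = unshift (f x) (π ν) := by
  have h := hf (unshift x ν) ν
  rw [shift_unshift] at h
  rw [h, unshift_shift]

/-- Such a bijection is an automorphism of the nearest-neighbour torus graph (`L ≥ 2`).
[cite: Koma2022, §4.1–4.2] -/
theorem adj_map_iff (h2 : 2 ≤ L) {f : FermionTorus (d + 1) L ≃ FermionTorus (d + 1) L}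
    {π : Equiv.Perm (Fin (d + 1))} (hf : ∀ x ν, f (shift x ν) = shift (f x) (π ν))
    (x y : FermionTorus (d + 1) L) : (G d L).Adj (f x) (f y) ↔ (G d L).Adj x y := by
  have hf' := map_unshift_of_map_shift hf
  rw [adj_iff_shift_or_unshift h2, adj_iff_shift_or_unshift h2]
  constructor
  · rintro (⟨μ, hμ⟩ | ⟨μ, hμ⟩)
    · refine Or.inl ⟨π.symm μ, f.injective ?_⟩
      rw [hf, Equiv.apply_symm_apply, hμ]
    · refine Or.inr ⟨π.symm μ, f.injective ?_⟩
      rw [hf', Equiv.apply_symm_apply, hμ]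
  · rintro (⟨μ, rfl⟩ | ⟨μ, rfl⟩)
    · exact Or.inl ⟨π μ, (hf x μ).symm⟩
    · exact Or.inr ⟨π μ, (hf' x μ).symm⟩

/-- The inverse bijection commutes with the shifts up to the inverse permutation. [cite: Koma2022, §4.1–4.2] -/
theorem symm_map_shift {f : FermionTorus (d + 1) L ≃ FermionTorus (d + 1) L}
    {π : Equiv.Perm (Fin (d + 1))} (hf : ∀ x ν, f (shift x ν) = shift (f x) (π ν))
    (x : FermionTorus (d + 1) L) (ν : Fin (d + 1)) : f.symm (shift x ν) = shift (f.symm x) (π.symm ν) := by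
  apply f.injective
  rw [Equiv.apply_symm_apply, hf, Equiv.apply_symm_apply, Equiv.apply_symm_apply]

/-- Powers commute with the shifts up to powers of the permutation. [cite: Koma2022, §4.1–4.2] -/
theorem pow_map_shift {f : Equiv.Perm (FermionTorus (d + 1) L)}
    {π : Equiv.Perm (Fin (d + 1))} (hf : ∀ x ν, f (shift x ν) = shift (f x) (π ν)) (n : ℕ)
    (x : FermionTorus (d + 1) L) (ν : Fin (d + 1)) : (f ^ n) (shift x ν) = shift ((f ^ n) x) ((π ^ n) ν) := by
  induction n generalizing x with
  | zero => simp
  | succ n ih => simp only [pow_succ', Equiv.Perm.mul_apply, ih, hf]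

/-- The cut coordinate after `a` unit translations along `e₀`. [cite: Koma2022, §4.1] -/
theorem col_pow_shiftEquiv (h2 : 2 ≤ L) (a : ℕ) (x : FermionTorus (d + 1) L) :
    col (((shiftEquiv (0 : Fin (d + 1))) ^ a) x) = (col x + a) % L := by
  induction a generalizing x with
  | zero => rw [pow_zero, Equiv.Perm.one_apply, add_zero, Nat.mod_eq_of_lt (col_lt x)]
  | succ n ih =>
    rw [pow_succ, Equiv.Perm.mul_apply, ih, shiftEquiv_apply, col_shift_zero,
      Nat.one_mod_eq_one.2 (by omega), Nat.mod_add_mod, add_assoc, add_comm 1 n]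

/-- The translation power by `e₀` iterated with the axis rotation: every bond direction can be
rotated onto the cut direction. [cite: Koma2022, §4.2] -/
theorem finRotate_pow_eq_zero (ν : Fin (d + 1)) : ∃ r : ℕ, ((finRotate (d + 1)) ^ r) ν = 0 := by
  rcases Nat.eq_zero_or_pos d with hd | hd
  · subst hd
    exact ⟨0, by rw [pow_zero, Equiv.Perm.one_apply]; exact Fin.eq_zero ν⟩
  · by_cases hν : ν = 0
    · exact ⟨0, by rw [pow_zero, Equiv.Perm.one_apply, hν]⟩
    · have hd2 : 2 ≤ d + 1 := by omega
      have hs := support_finRotate_of_le hd2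
      exact (isCycle_finRotate_of_le hd2).exists_pow_eq
        (by rw [← Equiv.Perm.mem_support, hs]; exact Finset.mem_univ _)
        (by rw [← Equiv.Perm.mem_support, hs]; exact Finset.mem_univ _)

/-- `finRotate (castSucc i) = i + 1` (index bookkeeping of the direction interchange). [cite: Koma2022, §4.2] -/
theorem finRotate_castSucc (i : Fin d) : finRotate (d + 1) (Fin.castSucc i) = i.succ := by
  apply Fin.ext
  rw [coe_finRotate_of_ne_last (Fin.castSucc_lt_last i).ne, Fin.val_castSucc, Fin.val_succ]

end Geometry

/-! ### The gauge functions and the covariance of `T_π` -/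

section GaugeFunctions

/-- The sum of the transverse coordinates `x₁ + ⋯ + x_d`. [cite: Koma2022, (4.5) (parities of coordinates)] -/
def transSum (x : FermionTorus (d + 1) L) : ℕ := ∑ k : Fin d, (ofLex x k.succ : ℕ)

/-- **The seam-relocating gauge of the unit translation along `e₀`**:
`ε(x) = (-1)^{x₁+⋯+x_d} u(x₀)`. [cite: Koma2022, §4.1 (4.1)] -/
def translateGauge (x : FermionTorus (d + 1) L) : ℝ := (-1) ^ transSum x * axialSign L (col x)

/-- **The direction-interchanging gauge of the axis rotation**: `ε(x) = (-1)^{x₀(x₁+⋯+x_d)}`, the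
product of Koma's `U_HA(1, j)`, `j = 2, …, d+1`. [cite: Koma2022, §4.2 (4.5)] -/
def rotateGauge (x : FermionTorus (d + 1) L) : ℝ := (-1) ^ (col x * transSum x)

omit [NeZero L] in
/-- `translateGauge x = ±1`. [cite: Koma2022, §4.1] -/
theorem translateGauge_sq (x : FermionTorus (d + 1) L) : translateGauge x * translateGauge x = 1 := by
  rw [translateGauge, mul_mul_mul_comm, ← pow_add, ← two_mul, pow_mul, neg_one_sq, one_pow, one_mul,
    axialSign_sq]

omit [NeZero L] in
/-- `rotateGauge x = ±1`. [cite: Koma2022, §4.2] -/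
theorem rotateGauge_sq (x : FermionTorus (d + 1) L) : rotateGauge x * rotateGauge x = 1 := by
  rw [rotateGauge, ← pow_add, ← two_mul, pow_mul, neg_one_sq, one_pow]

omit [NeZero L] in
/-- `axialSign L c = ±1`. [cite: Koma2022, (2.8)] -/
theorem axialSign_eq_or (L c : ℕ) : axialSign L c = 1 ∨ axialSign L c = -1 := by
  unfold axialSign; split_ifs
  · exact Or.inl rfl
  · exact Or.inr rfl

omit [NeZero L] in
/-- `translateGauge x ∈ {1, -1}`. [cite: Koma2022, §4.1] -/
theorem translateGauge_sign (x : FermionTorus (d + 1) L) : translateGauge x = 1 ∨ translateGauge x = -1 := by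
  rw [translateGauge]
  rcases neg_one_pow_eq_or ℝ (transSum x) with h | h <;>
    rcases axialSign_eq_or L (col x) with h' | h' <;> simp [h, h']

omit [NeZero L] in
/-- `rotateGauge x ∈ {1, -1}`. [cite: Koma2022, §4.2] -/
theorem rotateGauge_sign (x : FermionTorus (d + 1) L) : rotateGauge x = 1 ∨ rotateGauge x = -1 := by
  rw [rotateGauge]
  exact neg_one_pow_eq_or ℝ _

/-- Parity of a successor coordinate on the even torus: `(-1)^{(c+1) mod L} = -(-1)^c`.
[cite: Lieb1994, p. 3] -/
theorem neg_one_pow_val_add_one (hL : Even L) (a : Fin L) :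
    (-1 : ℝ) ^ ((a + 1 : Fin L) : ℕ) = -(-1) ^ (a : ℕ) := by
  have h2 : 2 ≤ L := by
    obtain ⟨k, hk⟩ := hL
    have := a.isLt
    have hne : L ≠ 0 := NeZero.ne L
    omega
  rw [Fin.val_add, Fin.val_one', Nat.add_mod_mod]
  by_cases h : (a : ℕ) + 1 < L
  · rw [Nat.mod_eq_of_lt h, pow_succ, mul_neg_one]
  · have ha : (a : ℕ) + 1 = L := by have := a.isLt; omega
    rw [ha, Nat.mod_self, pow_zero]
    have hodd : Odd (a : ℕ) := by
      obtain ⟨k, hk⟩ := hL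
      exact ⟨k - 1, by omega⟩
    rw [hodd.neg_one_pow, neg_neg]

/-- `(-1)^{col (x + e₀)} = -(-1)^{col x}` on the even torus. [cite: Lieb1994, p. 3] -/
theorem neg_one_pow_col_shift_zero (hL : Even L) (x : FermionTorus (d + 1) L) :
    (-1 : ℝ) ^ col (shift x 0) = -(-1) ^ col x := by
  rw [col_eq, col_eq, ofLex_shift, Function.update_self, neg_one_pow_val_add_one hL]

/-- The transverse coordinates of `x + e₀` are those of `x`. [cite: Lieb1994, pp. 2–3] -/
theorem ofLex_shift_zero_succ (x : FermionTorus (d + 1) L) (k : Fin d) :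
    ofLex (shift x 0) k.succ = ofLex x k.succ := by
  rw [ofLex_shift, Function.update_of_ne (Fin.succ_ne_zero k)]

/-- `transSum (x + e₀) = transSum x`. [cite: Koma2022, §4.1] -/
theorem transSum_shift_zero (x : FermionTorus (d + 1) L) : transSum (shift x 0) = transSum x :=
  Finset.sum_congr rfl fun k _ => by rw [ofLex_shift_zero_succ]

/-- `(-1)^{transSum (x + e_{i+1})} = -(-1)^{transSum x}` on the even torus. [cite: Koma2022, §4.2 (4.8)] -/
theorem neg_one_pow_transSum_shift_succ (hL : Even L) (x : FermionTorus (d + 1) L) (i : Fin d) :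
    (-1 : ℝ) ^ transSum (shift x i.succ) = -(-1) ^ transSum x := by
  rw [transSum, transSum, ← prod_pow_eq_pow_sum, ← prod_pow_eq_pow_sum,
    ← Finset.mul_prod_erase _ _ (Finset.mem_univ i), ← Finset.mul_prod_erase _ _ (Finset.mem_univ i),
    ofLex_shift, Function.update_self, neg_one_pow_val_add_one hL, neg_mul]
  congr 2
  refine Finset.prod_congr rfl fun k hk => ?_
  rw [Function.update_of_ne (fun h => (Finset.ne_of_mem_erase hk) (Fin.succ_injective _ h))]

/-- `transverseSign (x + e₀) i = transverseSign x i`. [cite: Koma2022, (2.9)] -/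
theorem transverseSign_shift_zero (x : FermionTorus (d + 1) L) (i : Fin d) :
    transverseSign (shift x 0) i = transverseSign x i := by
  unfold transverseSign
  simp only [ofLex_shift_zero_succ]

/-- **The unit translation along `e₀` maps `T_π` to a gauge transform of itself** (bondwise form):
`ε(x) ε(x + e_ν) t_ν(x) = t_ν(x + e₀)` with `ε = translateGauge`. [cite: Koma2022, §4.1 (4.1)–(4.2)] -/
theorem translateGauge_bondSign (hL : Even L) (x : FermionTorus (d + 1) L) (ν : Fin (d + 1)) :
    translateGauge x * translateGauge (shift x ν) * bondSign x ν = bondSign (shiftEquiv 0 x) ν := by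
  rw [shiftEquiv_apply]
  refine Fin.cases ?_ (fun i => ?_) ν
  · rw [bondSign_zero, bondSign_zero, translateGauge, translateGauge, transSum_shift_zero]
    calc (-1) ^ transSum x * axialSign L (col x) * ((-1) ^ transSum x * axialSign L (col (shift x 0))) *
          axialSign L (col x)
        = ((-1) ^ transSum x * (-1) ^ transSum x) * (axialSign L (col x) * axialSign L (col x)) *
            axialSign L (col (shift x 0)) := by ring
      _ = axialSign L (col (shift x 0)) := by
          rw [← pow_add, ← two_mul, pow_mul, neg_one_sq, one_pow, axialSign_sq, one_mul, one_mul]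
  · rw [bondSign_succ, bondSign_succ, translateGauge, translateGauge, col_shift_succ,
      neg_one_pow_transSum_shift_succ hL, neg_one_pow_col_shift_zero hL, transverseSign_shift_zero]
    calc (-1) ^ transSum x * axialSign L (col x) * (-(-1) ^ transSum x * axialSign L (col x)) *
          ((-1) ^ col x * transverseSign x i)
        = -(((-1) ^ transSum x * (-1) ^ transSum x) * (axialSign L (col x) * axialSign L (col x))) *
            ((-1) ^ col x * transverseSign x i) := by ring
      _ = -(-1) ^ col x * transverseSign x i := by
          rw [← pow_add, ← two_mul, pow_mul, neg_one_sq, one_pow, axialSign_sq]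
          ring

omit [NeZero L] in
/-- The uniform formula for the bond signs: `t_m(z) = (-1)^{Σ_{k<m} z_k} u(z_m)`.
[cite: Koma2022, (2.8)–(2.9)] -/
theorem bondSign_eq (z : FermionTorus (d + 1) L) (m : Fin (d + 1)) :
    bondSign z m = (-1) ^ (∑ k ∈ (univ : Finset (Fin (d + 1))).filter (· < m), (ofLex z k : ℕ)) *
      axialSign L (ofLex z m : ℕ) := by
  refine Fin.cases ?_ (fun i => ?_) m
  · rw [bondSign_zero, col_eq]
    have h0 : (univ : Finset (Fin (d + 1))).filter (· < (0 : Fin (d + 1))) = ∅ := by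
      ext k; simp
    rw [h0, Finset.sum_empty, pow_zero, one_mul]
  · rw [bondSign_succ, transverseSign, ← mul_assoc, ← pow_add, col_eq]
    congr 2
    rw [Finset.sum_filter, Finset.sum_filter, Fin.sum_univ_succ, if_pos (Fin.succ_pos i)]
    congr 1
    refine Finset.sum_congr rfl fun k _ => ?_
    simp only [Fin.succ_lt_succ_iff]

omit [NeZero L] in
/-- `transSum x = Σ_{k < last} x_{k+1}` reindexed along the axis rotation:
`Σ_{k < d} (rotateAxes x)_k = transSum x`. [cite: Koma2022, §4.2] -/
theorem sum_lt_last_rotateAxes (x : FermionTorus (d + 1) L) :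
    ∑ k ∈ (univ : Finset (Fin (d + 1))).filter (· < Fin.last d), (ofLex (rotateAxes x) k : ℕ) =
      transSum x := by
  rw [Finset.sum_filter, Fin.sum_univ_castSucc, if_neg (lt_irrefl _), add_zero, transSum]
  refine Finset.sum_congr rfl fun k _ => ?_
  rw [if_pos (Fin.castSucc_lt_last k), ofLex_rotateAxes, finRotate_castSucc]

omit [NeZero L] in
/-- `Σ_{k < castSucc i} (rotateAxes x)_k = Σ_{k < i} x_{k+1}`. [cite: Koma2022, §4.2] -/
theorem sum_lt_castSucc_rotateAxes (x : FermionTorus (d + 1) L) (i : Fin d) :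
    ∑ k ∈ (univ : Finset (Fin (d + 1))).filter (· < Fin.castSucc i), (ofLex (rotateAxes x) k : ℕ) =
      ∑ k ∈ (univ : Finset (Fin d)).filter (· < i), (ofLex x k.succ : ℕ) := by
  rw [Finset.sum_filter, Fin.sum_univ_castSucc, if_neg (not_lt.2 (Fin.castSucc_lt_last i).le), add_zero,
    Finset.sum_filter]
  refine Finset.sum_congr rfl fun k _ => ?_
  simp only [Fin.castSucc_lt_castSucc_iff]
  split_ifs
  · rw [ofLex_rotateAxes, finRotate_castSucc]
  · rfl

omit [NeZero L] in
/-- `(finRotate)⁻¹ 0 = last` (index bookkeeping of the direction interchange). [cite: Koma2022, §4.2] -/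
theorem finRotate_symm_zero : (finRotate (d + 1)).symm 0 = Fin.last d := by
  rw [Equiv.symm_apply_eq, finRotate_last]

omit [NeZero L] in
/-- `(finRotate)⁻¹ (i+1) = castSucc i` (index bookkeeping of the direction interchange). [cite: Koma2022, §4.2] -/
theorem finRotate_symm_succ (i : Fin d) : (finRotate (d + 1)).symm i.succ = Fin.castSucc i := by
  rw [Equiv.symm_apply_eq, finRotate_castSucc]

/-- **The axis rotation maps `T_π` to a gauge transform of itself** (bondwise form):
`ε(x) ε(x + e_ν) t_ν(x) = t_{ν-1}(rotateAxes x)` with `ε = rotateGauge`.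
[cite: Koma2022, §4.2 (4.5)–(4.9)] -/
theorem rotateGauge_bondSign (hL : Even L) (x : FermionTorus (d + 1) L) (ν : Fin (d + 1)) :
    rotateGauge x * rotateGauge (shift x ν) * bondSign x ν =
      bondSign (rotateAxes x) ((finRotate (d + 1)).symm ν) := by
  refine Fin.cases ?_ (fun i => ?_) ν
  · -- the bond along `e₀` becomes the bond along `e_d`
    rw [finRotate_symm_zero, bondSign_eq (rotateAxes x), sum_lt_last_rotateAxes, ofLex_rotateAxes,
      finRotate_last, bondSign_zero, col_eq, rotateGauge, rotateGauge, transSum_shift_zero, col_eq, col_eq,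
      ofLex_shift, Function.update_self, ← pow_add]
    congr 1
    rw [Fin.val_add, Fin.val_one', Nat.add_mod_mod]
    have hx := (ofLex x 0).isLt
    obtain ⟨k, hk⟩ := hL
    rcases Nat.even_or_odd (transSum x) with hS | hS
    · rw [hS.neg_one_pow, (Even.add (hS.mul_left _) (hS.mul_left _)).neg_one_pow]
    · rw [hS.neg_one_pow]
      by_cases hlt : (ofLex x 0 : ℕ) + 1 < L
      · rw [Nat.mod_eq_of_lt hlt]
        have hodd : Odd ((ofLex x 0 : ℕ) * transSum x + ((ofLex x 0 : ℕ) + 1) * transSum x) := by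
          rw [← add_mul]
          exact Odd.mul ⟨(ofLex x 0 : ℕ), by ring⟩ hS
        rw [hodd.neg_one_pow]
      · have heq : (ofLex x 0 : ℕ) + 1 = L := by omega
        rw [heq, Nat.mod_self, zero_mul, add_zero]
        have hodd : Odd ((ofLex x 0 : ℕ) * transSum x) :=
          Odd.mul ⟨k - 1, by omega⟩ hS
        rw [hodd.neg_one_pow]
  · -- the bond along `e_{i+1}` becomes the bond along `e_i`
    rw [finRotate_symm_succ, bondSign_eq (rotateAxes x), sum_lt_castSucc_rotateAxes, ofLex_rotateAxes,
      finRotate_castSucc, bondSign_succ, transverseSign, rotateGauge, rotateGauge, col_shift_succ, col_eq]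
    have hS : (-1 : ℝ) ^ ((ofLex x 0 : ℕ) * transSum (shift x i.succ)) =
        (-1) ^ (ofLex x 0 : ℕ) * (-1) ^ ((ofLex x 0 : ℕ) * transSum x) := by
      rw [pow_mul', pow_mul', neg_one_pow_transSum_shift_succ hL, neg_pow]
    rw [hS]
    calc (-1) ^ ((ofLex x 0 : ℕ) * transSum x) *
          ((-1) ^ (ofLex x 0 : ℕ) * (-1) ^ ((ofLex x 0 : ℕ) * transSum x)) *
          ((-1) ^ (ofLex x 0 : ℕ) *
            ((-1) ^ (∑ k ∈ univ.filter (· < i), (ofLex x k.succ : ℕ)) * axialSign L (ofLex x i.succ : ℕ)))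
        = ((-1) ^ ((ofLex x 0 : ℕ) * transSum x) * (-1) ^ ((ofLex x 0 : ℕ) * transSum x)) *
            ((-1) ^ (ofLex x 0 : ℕ) * (-1) ^ (ofLex x 0 : ℕ)) *
            ((-1) ^ (∑ k ∈ univ.filter (· < i), (ofLex x k.succ : ℕ)) * axialSign L (ofLex x i.succ : ℕ)) := by
          ring
      _ = (-1) ^ (∑ k ∈ univ.filter (· < i), (ofLex x k.succ : ℕ)) * axialSign L (ofLex x i.succ : ℕ) := by
          rw [← pow_add, ← two_mul, pow_mul, neg_one_sq, one_pow, ← pow_add, ← two_mul, pow_mul,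
            neg_one_sq, one_pow, one_mul, one_mul]

end GaugeFunctions

/-! ### `Z(h ∘ f) = Z(h)` for the symmetries of `T_π` -/

section Invariance

/-- **`T_π(f x, f y) = ε(x) ε(y) T_π(x, y)`** for a bijection `f` commuting with the shifts up to a
permutation `π` of the directions and a function `ε` with `ε(x) ε(x+e_ν) t_ν(x) = t_{πν}(f x)`.
[cite: Koma2022, §4.1–4.2] -/
theorem piFluxAmpl_map (κ : ℝ) {f : FermionTorus (d + 1) L ≃ FermionTorus (d + 1) L}
    {π : Equiv.Perm (Fin (d + 1))} (hf : ∀ x ν, f (shift x ν) = shift (f x) (π ν))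
    {ε : FermionTorus (d + 1) L → ℝ} (hε : ∀ x ν, ε x * ε (shift x ν) * bondSign x ν = bondSign (f x) (π ν))
    (σ : Fin 2) (x y : FermionTorus (d + 1) L) :
    piFluxAmpl κ σ (f x) (f y) = ((ε x * ε y : ℝ) : ℂ) * piFluxAmpl κ σ x y := by
  unfold piFluxAmpl
  rw [← Complex.ofReal_mul]
  congr 1
  rw [mul_left_comm]
  congr 1
  rw [Finset.mul_sum]
  symm
  refine Fintype.sum_equiv π _ _ fun ν => ?_
  rw [← hf x ν, ← hf y ν, mul_add]
  congr 1
  · by_cases hy : y = shift x ν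
    · rw [if_pos hy, if_pos (show f y = f (shift x ν) by rw [hy])]
      subst hy
      exact hε x ν
    · rw [if_neg hy, if_neg (fun h => hy (f.injective h)), mul_zero]
  · by_cases hx : x = shift y ν
    · rw [if_pos hx, if_pos (show f x = f (shift y ν) by rw [hx])]
      subst hx
      rw [mul_comm (ε (shift y ν)) (ε y)]
      exact hε y ν
    · rw [if_neg hx, if_neg (fun h => hx (f.injective h)), mul_zero]

/-- **Invariance of the partition function under a symmetry of `T_π` up to a `ℤ₂` gauge**:
`Z(T_π; h ∘ f) = Z(T_π; h)` — relabel by `f⁻¹` ([Koma2022] (4.2)), then undo the change of `T_π`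
by the gauge transformation ([Koma2022] (4.1), (4.5)). [cite: Koma2022, §4.1 (4.1)–(4.4), §4.2 (4.5)–(4.9)] -/
theorem partitionFn_map (h2 : 2 ≤ L) {f : FermionTorus (d + 1) L ≃ FermionTorus (d + 1) L}
    {π : Equiv.Perm (Fin (d + 1))} (hf : ∀ x ν, f (shift x ν) = shift (f x) (π ν))
    {ε : FermionTorus (d + 1) L → ℝ} (hε1 : ∀ x, ε x = 1 ∨ ε x = -1)
    (hε : ∀ x ν, ε x * ε (shift x ν) * bondSign x ν = bondSign (f x) (π ν))
    (κ U g : ℝ) (h : FermionTorus (d + 1) L → FermionTorus (d + 1) L → ℝ) (B β : ℝ) :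
    (hamiltonian κ U g (fun x y => h (f x) (f y)) B).partitionFn β = (hamiltonian κ U g h B).partitionFn β := by
  -- `Z(T_π, h ∘ f) = Z(ε T_π ε, h ∘ f)` (gauge) and `ε T_π ε = T_π ∘ f`
  have step1 := PairHopRP.partitionFn_hamiltonian_signGauge (G d L) ε hε1 (piFluxAmpl κ) U g
    (fun x y => h (f x) (f y)) B β
  have hT : (fun σ x' y' => ((ε x' * ε y' : ℝ) : ℂ) * piFluxAmpl κ σ x' y') =
      fun σ x' y' => piFluxAmpl κ σ (f x') (f y') := by
    funext σ x' y'
    exact (piFluxAmpl_map κ hf hε σ x' y').symm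
  rw [hT] at step1
  -- `Z(T_π ∘ f, h ∘ f) = Z(T_π, h)` (relabelling by `f⁻¹`)
  have hG : ∀ x y, (G d L).Adj (f.symm x) (f.symm y) ↔ (G d L).Adj x y := fun x y => by
    rw [← adj_map_iff h2 hf (f.symm x) (f.symm y), Equiv.apply_symm_apply, Equiv.apply_symm_apply]
  have step2 := PairHopRP.partitionFn_hamiltonian_relabel (G d L) (G d L) f.symm hG (piFluxAmpl κ) U g h B β
  simp only [Equiv.symm_symm] at step2
  rw [hamiltonian, hamiltonian, ← step1]
  exact step2

/-- **Lattice-shift invariance** `Z(h ∘ τ) = Z(h)` for the unit translation `τ` along `e₀`.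
[cite: Koma2022, §4.1 (4.3)–(4.4)] -/
theorem partitionFn_translate (hL : Even L) (h2 : 2 ≤ L) (κ U g : ℝ)
    (h : FermionTorus (d + 1) L → FermionTorus (d + 1) L → ℝ) (B β : ℝ) :
    (hamiltonian κ U g (fun x y => h (shiftEquiv 0 x) (shiftEquiv 0 y)) B).partitionFn β =
      (hamiltonian κ U g h B).partitionFn β :=
  partitionFn_map h2 (π := 1) (fun x ν => shiftEquiv_zero_shift x ν) translateGauge_sign
    (translateGauge_bondSign hL) κ U g h B β

/-- **Direction-interchange invariance** `Z(h ∘ ρ) = Z(h)` for the axis rotation `ρ`.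
[cite: Koma2022, §4.2 (4.5)–(4.9)] -/
theorem partitionFn_rotateAxes (hL : Even L) (h2 : 2 ≤ L) (κ U g : ℝ)
    (h : FermionTorus (d + 1) L → FermionTorus (d + 1) L → ℝ) (B β : ℝ) :
    (hamiltonian κ U g (fun x y => h (rotateAxes x) (rotateAxes y)) B).partitionFn β =
      (hamiltonian κ U g h B).partitionFn β :=
  partitionFn_map h2 rotateAxes_shift rotateGauge_sign (rotateGauge_bondSign hL) κ U g h B β

end Invariance

/-! ### The symmetry group moves every bond onto the cutting plane -/

section Reach

variable (E : (FermionTorus (d + 1) L → FermionTorus (d + 1) L → ℝ) → ℝ)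

omit [NeZero L] in
/-- Invariance of a function of the field passes to the inverse symmetry. [cite: DLS1978, Thm. 4.2 (proof)] -/
theorem invariant_symm {f : FermionTorus (d + 1) L ≃ FermionTorus (d + 1) L}
    (hE : ∀ h, E (fun a b => h (f a) (f b)) = E h) (h : FermionTorus (d + 1) L → FermionTorus (d + 1) L → ℝ) :
    E (fun a b => h (f.symm a) (f.symm b)) = E h := by
  rw [← hE (fun a b => h (f.symm a) (f.symm b))]
  simp only [Equiv.symm_apply_apply]

omit [NeZero L] in
/-- Invariance passes to powers. [cite: DLS1978, Thm. 4.2 (proof)] -/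
theorem invariant_pow {f : Equiv.Perm (FermionTorus (d + 1) L)}
    (hE : ∀ h, E (fun a b => h (f a) (f b)) = E h) (n : ℕ)
    (h : FermionTorus (d + 1) L → FermionTorus (d + 1) L → ℝ) :
    E (fun a b => h ((f ^ n) a) ((f ^ n) b)) = E h := by
  induction n generalizing h with
  | zero => simp
  | succ n ih =>
    have key := ih (fun a b => h (f a) (f b))
    simp only [pow_succ', Equiv.Perm.mul_apply]
    exact key.trans (hE h)

/-- **Every bond can be moved onto a bond through the plane `P ⊥ e₀`** by a composite of axis
rotations and translations along `e₀`, all of which preserve `E` and the graph: for every site `x`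
and direction `ν` there is such a `φ` with `φ x` on the boundary layer `L/2 - 1` and
`φ (x + e_ν) = φ x + e₀` on the layer `L/2`. [cite: Koma2022, p. 21 (before Thm. 5.3)] [cite: DLS1978, Thm. 4.2 (proof)] -/
theorem exists_symmetry_to_cut (hL : Even L) (h2 : 2 ≤ L)
    (hEτ : ∀ h, E (fun a b => h (shiftEquiv 0 a) (shiftEquiv 0 b)) = E h)
    (hEρ : ∀ h, E (fun a b => h (rotateAxes a) (rotateAxes b)) = E h)
    (x : FermionTorus (d + 1) L) (ν : Fin (d + 1)) :
    ∃ φ : FermionTorus (d + 1) L ≃ FermionTorus (d + 1) L,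
      (∀ h, E (fun a b => h (φ a) (φ b)) = E h) ∧
      (∀ a b, (G d L).Adj (φ a) (φ b) ↔ (G d L).Adj a b) ∧
      col (φ x) + 1 = L / 2 ∧ φ (shift x ν) = shift (φ x) 0 := by
  -- rotate the direction `ν` onto `0`
  obtain ⟨r, hr⟩ := finRotate_pow_eq_zero ν
  obtain ⟨ρ, hρdef⟩ : ∃ ρ : Equiv.Perm (FermionTorus (d + 1) L), ρ = (rotateAxes (d := d) (L := L)).symm :=
    ⟨_, rfl⟩
  have hρs : ∀ x ν, ρ (shift x ν) = shift (ρ x) ((finRotate (d + 1)) ν) := by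
    intro x ν
    have h := symm_map_shift rotateAxes_shift x ν
    rw [Equiv.symm_symm] at h
    rw [hρdef]
    exact h
  have hρE : ∀ h, E (fun a b => h (ρ a) (ρ b)) = E h := by
    rw [hρdef]
    exact invariant_symm E hEρ
  have hρr := pow_map_shift hρs r
  -- translate to the boundary layer
  obtain ⟨τ, hτdef⟩ : ∃ τ : Equiv.Perm (FermionTorus (d + 1) L), τ = shiftEquiv (L := L) (0 : Fin (d + 1)) :=
    ⟨_, rfl⟩
  have hτs : ∀ x ν, τ (shift x ν) = shift (τ x) ((1 : Equiv.Perm (Fin (d + 1))) ν) := fun x ν => by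
    rw [Equiv.Perm.one_apply, hτdef]
    exact shiftEquiv_zero_shift x ν
  have hτE : ∀ h, E (fun a b => h (τ a) (τ b)) = E h := by
    rw [hτdef]
    exact hEτ
  obtain ⟨n, hndef⟩ : ∃ n : ℕ, n = L / 2 - 1 + L - FermionTorus.Cut.col ((ρ ^ r) x) := ⟨_, rfl⟩
  have hτn := pow_map_shift hτs n
  refine ⟨(ρ ^ r).trans (τ ^ n), fun h => ?_, fun p q => ?_, ?_, ?_⟩
  · have h1 := invariant_pow E hρE r (fun p q => h ((τ ^ n) p) ((τ ^ n) q))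
    have h2 := invariant_pow E hτE n h
    simp only [Equiv.trans_apply]
    exact h1.trans h2
  · simp only [Equiv.trans_apply]
    rw [adj_map_iff h2 hτn, adj_map_iff h2 hρr]
  · simp only [Equiv.trans_apply]
    rw [hτdef, col_pow_shiftEquiv h2, hndef]
    have hcy := col_lt ((ρ ^ r) x)
    obtain ⟨k, hk⟩ := hL
    rw [show FermionTorus.Cut.col ((ρ ^ r) x) + (L / 2 - 1 + L - FermionTorus.Cut.col ((ρ ^ r) x)) =
        (L / 2 - 1) + L by omega, Nat.add_mod_right, Nat.mod_eq_of_lt (by omega)]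
    omega
  · simp only [Equiv.trans_apply]
    rw [hρr, hr, hτn, one_pow, Equiv.Perm.one_apply]

end Reach

/-! ### Counting the bonds that carry a field -/

section Count

/-- The number of ordered pairs `(p, q) ∈ s × t` of adjacent sites with `h(p, q) ≠ 0`.
[cite: DLS1978, Thm. 4.2 (proof: "the number of bonds with `h ≠ 0`")] -/
def blockCount (s t : Finset (FermionTorus (d + 1) L))
    (h : FermionTorus (d + 1) L → FermionTorus (d + 1) L → ℝ) : ℕ :=
  ∑ p ∈ s, ∑ q ∈ t, if (G d L).Adj p q ∧ h p q ≠ 0 then 1 else 0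

/-- The number of ordered adjacent pairs carrying a nonzero field. [cite: DLS1978, Thm. 4.2 (proof)] -/
def nonzeroBondCount (h : FermionTorus (d + 1) L → FermionTorus (d + 1) L → ℝ) : ℕ :=
  blockCount univ univ h

/-- The left sites as a finset. [cite: Lieb1994, p. 2] -/
def leftSet (d L : ℕ) : Finset (FermionTorus (d + 1) L) := univ.filter fun x => IsLeft L x

/-- The right sites as a finset. [cite: Lieb1994, p. 2] -/
def rightSet (d L : ℕ) : Finset (FermionTorus (d + 1) L) := univ.filter fun x => ¬IsLeft L x

omit [NeZero L] in
/-- Membership in `leftSet`. [cite: Lieb1994, p. 2] -/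
@[simp] theorem mem_leftSet {x : FermionTorus (d + 1) L} : x ∈ leftSet d L ↔ IsLeft L x := by
  simp [leftSet]

omit [NeZero L] in
/-- Membership in `rightSet`. [cite: Lieb1994, p. 2] -/
@[simp] theorem mem_rightSet {x : FermionTorus (d + 1) L} : x ∈ rightSet d L ↔ ¬IsLeft L x := by
  simp [rightSet]

omit [NeZero L] in
/-- The right half is the mirror image of the left half: sums over the right sites are sums over
the reflected left sites. [cite: Lieb1994, p. 2 ("mirror images")] -/
theorem sum_rightSet_eq (hL : Even L) {M : Type*} [AddCommMonoid M] (F : FermionTorus (d + 1) L → M) :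
    ∑ p ∈ rightSet d L, F p = ∑ p ∈ leftSet d L, F (reflect p) := by
  have himg : (leftSet d L).image reflect = rightSet d L := by
    ext q
    simp only [Finset.mem_image, mem_leftSet, mem_rightSet]
    constructor
    · rintro ⟨p, hp, rfl⟩
      rwa [isLeft_reflect_iff hL, not_not]
    · intro hq
      exact ⟨reflect q, (isLeft_reflect_iff hL q).2 hq, reflect_reflect q⟩
  rw [← himg, Finset.sum_image fun p _ q _ hpq => by
    rw [← reflect_reflect p, hpq, reflect_reflect]]

omit [NeZero L] in
/-- The same, read from left to right. [cite: Lieb1994, p. 2] -/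
theorem sum_leftSet_eq (hL : Even L) {M : Type*} [AddCommMonoid M] (F : FermionTorus (d + 1) L → M) :
    ∑ p ∈ leftSet d L, F p = ∑ p ∈ rightSet d L, F (reflect p) := by
  rw [sum_rightSet_eq hL]
  simp only [reflect_reflect]

omit [NeZero L] in
/-- The count splits into the four blocks `LL, LR, RL, RR`. [cite: DLS1978, Thm. 4.2 (proof)] -/
theorem nonzeroBondCount_eq (h : FermionTorus (d + 1) L → FermionTorus (d + 1) L → ℝ) :
    nonzeroBondCount h = blockCount (leftSet d L) (leftSet d L) h + blockCount (leftSet d L) (rightSet d L) h +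
      (blockCount (rightSet d L) (leftSet d L) h + blockCount (rightSet d L) (rightSet d L) h) := by
  unfold nonzeroBondCount blockCount leftSet rightSet
  rw [← Finset.sum_filter_add_sum_filter_not univ (fun x => IsLeft L x)]
  congr 1
  · rw [← Finset.sum_add_distrib]
    exact Finset.sum_congr rfl fun p _ => (Finset.sum_filter_add_sum_filter_not univ (fun x => IsLeft L x) _).symm
  · rw [← Finset.sum_add_distrib]
    exact Finset.sum_congr rfl fun p _ => (Finset.sum_filter_add_sum_filter_not univ (fun x => IsLeft L x) _).symm

omit [NeZero L] in
/-- A block count only sees the field on its block. [cite: DLS1978, Thm. 4.2 (proof)] -/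
theorem blockCount_congr {s t : Finset (FermionTorus (d + 1) L)}
    {h h' : FermionTorus (d + 1) L → FermionTorus (d + 1) L → ℝ}
    (hh : ∀ p ∈ s, ∀ q ∈ t, h p q = h' p q) : blockCount s t h = blockCount s t h' := by
  unfold blockCount
  exact Finset.sum_congr rfl fun p hp => Finset.sum_congr rfl fun q hq => by rw [hh p hp q hq]

omit [NeZero L] in
/-- A block on which the field vanishes counts nothing. [cite: DLS1978, Thm. 4.2 (proof)] -/
theorem blockCount_eq_zero {s t : Finset (FermionTorus (d + 1) L)}
    {h : FermionTorus (d + 1) L → FermionTorus (d + 1) L → ℝ} (hh : ∀ p ∈ s, ∀ q ∈ t, h p q = 0) :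
    blockCount s t h = 0 := by
  unfold blockCount
  exact Finset.sum_eq_zero fun p hp => Finset.sum_eq_zero fun q hq => by
    rw [if_neg (fun hc => hc.2 (hh p hp q hq))]

/-- The `RR` block of a reflected field is the `LL` block of the field. [cite: DLS1978, Thm. 4.2 (proof)] -/
theorem blockCount_right_right_reflect (hL : Even L) (h2 : 2 ≤ L)
    (h : FermionTorus (d + 1) L → FermionTorus (d + 1) L → ℝ) :
    blockCount (rightSet d L) (rightSet d L) (fun p q => h (reflect p) (reflect q)) =
      blockCount (leftSet d L) (leftSet d L) h := by
  unfold blockCount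
  rw [sum_rightSet_eq hL]
  refine Finset.sum_congr rfl fun p _ => ?_
  rw [sum_rightSet_eq hL]
  refine Finset.sum_congr rfl fun q _ => ?_
  simp only [reflect_reflect, adj_reflect_iff h2]

/-- The `LL` block of a reflected field is the `RR` block of the field. [cite: DLS1978, Thm. 4.2 (proof)] -/
theorem blockCount_left_left_reflect (hL : Even L) (h2 : 2 ≤ L)
    (h : FermionTorus (d + 1) L → FermionTorus (d + 1) L → ℝ) :
    blockCount (leftSet d L) (leftSet d L) (fun p q => h (reflect p) (reflect q)) =
      blockCount (rightSet d L) (rightSet d L) h := by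
  unfold blockCount
  rw [sum_leftSet_eq hL]
  refine Finset.sum_congr rfl fun p _ => ?_
  rw [sum_leftSet_eq hL]
  refine Finset.sum_congr rfl fun q _ => ?_
  simp only [reflect_reflect, adj_reflect_iff h2]

/-- `N(h_LL) = 2 N_LL(h)`. [cite: DLS1978, Thm. 4.2 (proof)] [cite: Koma2022, (5.96)–(5.98)] -/
theorem nonzeroBondCount_fieldLL (hL : Even L) (h2 : 2 ≤ L)
    (h : FermionTorus (d + 1) L → FermionTorus (d + 1) L → ℝ) :
    nonzeroBondCount (fieldLL h) = 2 * blockCount (leftSet d L) (leftSet d L) h := by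
  rw [nonzeroBondCount_eq,
    blockCount_congr (h' := h) (fun p hp q hq => fieldLL_of_left h (mem_leftSet.1 hp) (mem_leftSet.1 hq)),
    blockCount_eq_zero (fun p hp q hq => (fieldLL_of_cut h (mem_leftSet.1 hp) (mem_rightSet.1 hq)).1),
    blockCount_eq_zero (fun p hp q hq => (fieldLL_of_cut h (mem_leftSet.1 hq) (mem_rightSet.1 hp)).2),
    blockCount_congr (h' := fun p q => h (reflect p) (reflect q))
      (fun p hp q hq => fieldLL_of_right h (mem_rightSet.1 hp) (mem_rightSet.1 hq)),
    blockCount_right_right_reflect hL h2]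
  ring

/-- `N(h_RR) = 2 N_RR(h)`. [cite: DLS1978, Thm. 4.2 (proof)] [cite: Koma2022, (5.93)–(5.95)] -/
theorem nonzeroBondCount_fieldRR (hL : Even L) (h2 : 2 ≤ L)
    (h : FermionTorus (d + 1) L → FermionTorus (d + 1) L → ℝ) :
    nonzeroBondCount (fieldRR h) = 2 * blockCount (rightSet d L) (rightSet d L) h := by
  rw [nonzeroBondCount_eq,
    blockCount_congr (h' := fun p q => h (reflect p) (reflect q))
      (fun p hp q hq => fieldRR_of_left h (mem_leftSet.1 hp) (mem_leftSet.1 hq)),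
    blockCount_eq_zero (fun p hp q hq => (fieldRR_of_cut h (mem_leftSet.1 hp) (mem_rightSet.1 hq)).1),
    blockCount_eq_zero (fun p hp q hq => (fieldRR_of_cut h (mem_leftSet.1 hq) (mem_rightSet.1 hp)).2),
    blockCount_congr (h' := h) (fun p hp q hq => fieldRR_of_right h (mem_rightSet.1 hp) (mem_rightSet.1 hq)),
    blockCount_left_left_reflect hL h2]
  ring

/-- **The bond count of [DLS1978]**: `N(h_LL) + N(h_RR) + 2 N_cut(h) = 2 N(h)`, `N_cut` the number
of ordered pairs through the plane carrying a nonzero field. [cite: DLS1978, Thm. 4.2 (proof)] -/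
theorem nonzeroBondCount_reflect (hL : Even L) (h2 : 2 ≤ L)
    (h : FermionTorus (d + 1) L → FermionTorus (d + 1) L → ℝ) :
    nonzeroBondCount (fieldLL h) + nonzeroBondCount (fieldRR h) +
        2 * (blockCount (leftSet d L) (rightSet d L) h + blockCount (rightSet d L) (leftSet d L) h) =
      2 * nonzeroBondCount h := by
  rw [nonzeroBondCount_fieldLL hL h2, nonzeroBondCount_fieldRR hL h2, nonzeroBondCount_eq h]
  ring

omit [NeZero L] in
/-- A pair in the block with a nonzero field makes the block count positive. [cite: DLS1978, Thm. 4.2 (proof)] -/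
theorem one_le_blockCount {s t : Finset (FermionTorus (d + 1) L)}
    {h : FermionTorus (d + 1) L → FermionTorus (d + 1) L → ℝ} {p q : FermionTorus (d + 1) L}
    (hp : p ∈ s) (hq : q ∈ t) (hadj : (G d L).Adj p q) (hne : h p q ≠ 0) : 1 ≤ blockCount s t h := by
  unfold blockCount
  calc 1 = (if (G d L).Adj p q ∧ h p q ≠ 0 then 1 else 0) := by rw [if_pos ⟨hadj, hne⟩]
    _ ≤ ∑ q' ∈ t, (if (G d L).Adj p q' ∧ h p q' ≠ 0 then 1 else 0) :=
        Finset.single_le_sum (f := fun q' => if (G d L).Adj p q' ∧ h p q' ≠ 0 then 1 else 0)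
          (fun _ _ => Nat.zero_le _) hq
    _ ≤ _ := Finset.single_le_sum (f := fun p' => ∑ q' ∈ t, if (G d L).Adj p' q' ∧ h p' q' ≠ 0 then 1 else 0)
          (fun _ _ => Nat.zero_le _) hp

omit [NeZero L] in
/-- A field with count zero vanishes on every bond. [cite: DLS1978, Thm. 4.2 (proof)] -/
theorem eq_zero_of_nonzeroBondCount_eq_zero {h : FermionTorus (d + 1) L → FermionTorus (d + 1) L → ℝ}
    (hN : nonzeroBondCount h = 0) {p q : FermionTorus (d + 1) L} (hadj : (G d L).Adj p q) : h p q = 0 := by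
  by_contra hne
  have h1 := one_le_blockCount (s := univ) (t := univ) (mem_univ p) (mem_univ q) hadj hne
  rw [← nonzeroBondCount.eq_1, hN] at h1
  exact Nat.not_succ_le_zero 0 h1

omit [NeZero L] in
/-- A field with positive count has an adjacent ordered pair with a nonzero field.
[cite: DLS1978, Thm. 4.2 (proof)] -/
theorem exists_pair_of_nonzeroBondCount_ne_zero {h : FermionTorus (d + 1) L → FermionTorus (d + 1) L → ℝ}
    (hN : nonzeroBondCount h ≠ 0) : ∃ p q, (G d L).Adj p q ∧ h p q ≠ 0 := by
  obtain ⟨p, -, hp⟩ := Finset.exists_ne_zero_of_sum_ne_zero hN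
  obtain ⟨q, -, hq⟩ := Finset.exists_ne_zero_of_sum_ne_zero hp
  by_cases hc : (G d L).Adj p q ∧ h p q ≠ 0
  · exact ⟨p, q, hc⟩
  · rw [if_neg hc] at hq
    exact absurd rfl hq

omit [NeZero L] in
/-- The count is invariant under graph automorphisms. [cite: DLS1978, Thm. 4.2 (proof)] -/
theorem nonzeroBondCount_map (φ : FermionTorus (d + 1) L ≃ FermionTorus (d + 1) L)
    (hφ : ∀ a b, (G d L).Adj (φ a) (φ b) ↔ (G d L).Adj a b)
    (h : FermionTorus (d + 1) L → FermionTorus (d + 1) L → ℝ) :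
    nonzeroBondCount (fun a b => h (φ a) (φ b)) = nonzeroBondCount h := by
  unfold nonzeroBondCount blockCount
  symm
  rw [← φ.sum_comp]
  refine Finset.sum_congr rfl fun p _ => ?_
  rw [← φ.sum_comp]
  refine Finset.sum_congr rfl fun q _ => ?_
  simp only [hφ]

end Count

/-! ### The descent of [DLS1978, Thm. 4.2] for bond fields, once -/

section Descent

/-- **The descent of Dyson–Lieb–Simon for bond fields, abstractly** ([DLS1978] proof of Thm. 4.2,
as invoked by [Koma2022] for Thm. 5.3): on the even torus `(ℤ/Lℤ)^{d+1}`, `L ≥ 4`, let `E` be ANY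
real function of the real fields `h` on the ordered pairs of sites such that (i) at the plane
`P ⊥ e₀`, `½E(h_LL) + ½E(h_RR) ≤ E(h)`; (ii) `E(h) = E(0)` whenever `h` vanishes on all bonds; and
(iii) every bond `{x, x + e_ν}` is moved onto a bond through `P` by a graph automorphism `φ` with
`E(h ∘ φ) = E(h)` for all `h`. Then `E(0) ≤ E(h)` for every `h`. Proof as printed: minimise `E`
over the finitely many fields with values among those of `h` and `0`, then minimise the number `N`
of ordered bonds with `h ≠ 0`; if `N > 0`, move a bond with `h ≠ 0` onto the plane; the two
reflected configurations are again minimisers and `N(h_LL) + N(h_RR) + 2N_cut = 2N` with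
`N_cut ≥ 1`, so one of them has smaller `N` — contradiction; hence the minimiser vanishes on all
bonds and `E(min) = E(0)`. [cite: DLS1978, Thm. 4.2 (proof)] [cite: Koma2022, Thm. 5.3 (proof, p. 21)] -/
theorem gaussianDomination_descent (hL : Even L) (h4 : 4 ≤ L)
    (E : (FermionTorus (d + 1) L → FermionTorus (d + 1) L → ℝ) → ℝ)
    (hRP : ∀ h, (E (fieldLL h) + E (fieldRR h)) / 2 ≤ E h)
    (h0 : ∀ h : FermionTorus (d + 1) L → FermionTorus (d + 1) L → ℝ,
      (∀ x y, (G d L).Adj x y → h x y = 0) → E h = E (fun _ _ => 0))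
    (hreach : ∀ (x : FermionTorus (d + 1) L) (ν : Fin (d + 1)),
      ∃ φ : FermionTorus (d + 1) L ≃ FermionTorus (d + 1) L,
        (∀ h, E (fun a b => h (φ a) (φ b)) = E h) ∧
        (∀ a b, (G d L).Adj (φ a) (φ b) ↔ (G d L).Adj a b) ∧
        col (φ x) + 1 = L / 2 ∧ φ (shift x ν) = shift (φ x) 0)
    (h : FermionTorus (d + 1) L → FermionTorus (d + 1) L → ℝ) : E (fun _ _ => 0) ≤ E h := by
  classical
  have h2 : 2 ≤ L := by omega
  -- the finite search space: fields with values among those of `h` and `0`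
  set V : Finset ℝ := insert 0 ((univ : Finset (FermionTorus (d + 1) L × FermionTorus (d + 1) L)).image
    fun pq => h pq.1 pq.2) with hV
  have h0V : (0 : ℝ) ∈ V := Finset.mem_insert_self _ _
  have hhV : ∀ p q, h p q ∈ V := fun p q =>
    Finset.mem_insert_of_mem (Finset.mem_image_of_mem (fun pq : _ × _ => h pq.1 pq.2) (Finset.mem_univ (p, q)))
  set Ef : (FermionTorus (d + 1) L → FermionTorus (d + 1) L → V) → ℝ :=
    fun f => E (fun p q => (f p q : ℝ)) with hEf
  set Nf : (FermionTorus (d + 1) L → FermionTorus (d + 1) L → V) → ℕ :=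
    fun f => nonzeroBondCount (fun p q => (f p q : ℝ)) with hNf
  set hV' : FermionTorus (d + 1) L → FermionTorus (d + 1) L → V := fun p q => ⟨h p q, hhV p q⟩ with hhV'
  haveI : Nonempty (FermionTorus (d + 1) L → FermionTorus (d + 1) L → V) := ⟨hV'⟩
  obtain ⟨f₀, hf₀⟩ := Finite.exists_min Ef
  set S : Finset (FermionTorus (d + 1) L → FermionTorus (d + 1) L → V) :=
    univ.filter fun f => Ef f = Ef f₀ with hS
  obtain ⟨f₁, hf₁S, hf₁min⟩ := S.exists_min_image Nf ⟨f₀, by simp [hS]⟩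
  have hEf₁ : Ef f₁ = Ef f₀ := (Finset.mem_filter.1 hf₁S).2
  -- the minimiser vanishes on every bond
  have hN0 : Nf f₁ = 0 := by
    by_contra hN
    obtain ⟨p, q, hadj, hpq⟩ := exists_pair_of_nonzeroBondCount_ne_zero hN
    -- orient the bad pair as `(x, x + e_ν)` or `(x + e_ν, x)`
    obtain ⟨x, ν, hor⟩ : ∃ (x : FermionTorus (d + 1) L) (ν : Fin (d + 1)),
        (p = x ∧ q = shift x ν) ∨ (q = x ∧ p = shift x ν) := by
      rcases (adj_iff_shift_or_unshift h2 p q).1 hadj with ⟨μ, hμ⟩ | ⟨μ, hμ⟩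
      · exact ⟨p, μ, Or.inl ⟨rfl, hμ.symm⟩⟩
      · exact ⟨q, μ, Or.inr ⟨rfl, by rw [← hμ, shift_unshift]⟩⟩
    obtain ⟨φ, hφE, hφG, hφx, hφν⟩ := hreach x ν
    -- the transported field `f₁ ∘ φ⁻¹`: same energy, same count, nonzero on a cut pair
    set g₁ : FermionTorus (d + 1) L → FermionTorus (d + 1) L → V := fun a b => f₁ (φ.symm a) (φ.symm b)
      with hg₁
    have hEg : Ef g₁ = Ef f₁ := by
      have := hφE (fun a b => (f₁ (φ.symm a) (φ.symm b) : ℝ))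
      simp only [Equiv.symm_apply_apply] at this
      exact this.symm
    have hφG' : ∀ a b, (G d L).Adj (φ.symm a) (φ.symm b) ↔ (G d L).Adj a b := fun a b => by
      rw [← hφG, Equiv.apply_symm_apply, Equiv.apply_symm_apply]
    have hNg : Nf g₁ = Nf f₁ := nonzeroBondCount_map φ.symm hφG' (fun a b => (f₁ a b : ℝ))
    have hleft : IsLeft L (φ x) := by rw [isLeft_iff]; omega
    have hright : ¬IsLeft L (shift (φ x) 0) := by
      rw [isLeft_iff, col_shift_zero, Nat.one_mod_eq_one.2 (by omega), hφx, Nat.mod_eq_of_lt (by omega)]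
      exact lt_irrefl _
    have hcut : 1 ≤ blockCount (leftSet d L) (rightSet d L) (fun a b => (g₁ a b : ℝ)) +
        blockCount (rightSet d L) (leftSet d L) (fun a b => (g₁ a b : ℝ)) := by
      rcases hor with ⟨rfl, rfl⟩ | ⟨rfl, rfl⟩
      · have h1 : 1 ≤ blockCount (leftSet d L) (rightSet d L) (fun a b => (g₁ a b : ℝ)) :=
          one_le_blockCount (p := φ p) (q := φ (shift p ν)) (mem_leftSet.2 hleft)
            (by rw [hφν]; exact mem_rightSet.2 hright) ((hφG _ _).2 hadj)
            (by simp only [hg₁, Equiv.symm_apply_apply]; exact hpq)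
        omega
      · have h1 : 1 ≤ blockCount (rightSet d L) (leftSet d L) (fun a b => (g₁ a b : ℝ)) :=
          one_le_blockCount (p := φ (shift q ν)) (q := φ q) (by rw [hφν]; exact mem_rightSet.2 hright)
            (mem_leftSet.2 hleft) ((hφG _ _).2 hadj)
            (by simp only [hg₁, Equiv.symm_apply_apply]; exact hpq)
        omega
    -- the reflected configurations
    set ψ : FermionTorus (d + 1) L → FermionTorus (d + 1) L → ℝ := fun a b => (g₁ a b : ℝ) with hψ
    have hmemL : ∀ a b, fieldLL ψ a b ∈ V := fun a b => by
      unfold fieldLL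
      split_ifs
      · exact (g₁ _ _).2
      · exact (g₁ _ _).2
      · exact h0V
    have hmemR : ∀ a b, fieldRR ψ a b ∈ V := fun a b => by
      unfold fieldRR
      split_ifs
      · exact (g₁ _ _).2
      · exact (g₁ _ _).2
      · exact h0V
    set gL : FermionTorus (d + 1) L → FermionTorus (d + 1) L → V := fun a b => ⟨fieldLL ψ a b, hmemL a b⟩
      with hgL
    set gR : FermionTorus (d + 1) L → FermionTorus (d + 1) L → V := fun a b => ⟨fieldRR ψ a b, hmemR a b⟩
      with hgR
    have hEL : Ef gL = E (fieldLL ψ) := rfl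
    have hER : Ef gR = E (fieldRR ψ) := rfl
    have hEg' : Ef g₁ = E ψ := rfl
    -- energies: both reflected fields are minimisers
    have hRP' := hRP ψ
    have h1 := hf₀ gL
    have h2' := hf₀ gR
    rw [← hEL, ← hER, ← hEg', hEg, hEf₁] at hRP'
    have hELm : Ef gL = Ef f₀ := by linarith
    have hERm : Ef gR = Ef f₀ := by linarith
    have hNL : Nf f₁ ≤ Nf gL := hf₁min gL (by simp [hS, hELm])
    have hNR : Nf f₁ ≤ Nf gR := hf₁min gR (by simp [hS, hERm])
    -- counting
    have hcount := nonzeroBondCount_reflect hL h2 ψ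
    have hNLψ : Nf gL = nonzeroBondCount (fieldLL ψ) := rfl
    have hNRψ : Nf gR = nonzeroBondCount (fieldRR ψ) := rfl
    have hNgψ : Nf g₁ = nonzeroBondCount ψ := rfl
    rw [hNLψ, ← hNg, hNgψ] at hNL
    rw [hNRψ, ← hNg, hNgψ] at hNR
    omega
  -- hence `E(f₁) = E(0)` and `E(0) = E(f₁) ≤ E(h)`
  have h1 : Ef f₁ = E (fun _ _ => 0) :=
    h0 _ fun x y hxy => eq_zero_of_nonzeroBondCount_eq_zero hN0 hxy
  have hEh : Ef hV' = E h := rfl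
  rw [← hEh, ← h1, hEf₁]
  exact hf₀ hV'

end Descent

/-! ### Theorem 5.3: Gaussian domination -/

section Main

/-- `x² ≤ yz`, `y, z ≥ 0` ⟹ `x ≤ ½(y + z)`. [folklore] -/
private theorem le_half_add_of_sq_le_mul' {x y z : ℝ} (hy : 0 ≤ y) (hz : 0 ≤ z) (h : x ^ 2 ≤ y * z) :
    x ≤ (y + z) / 2 := by
  nlinarith [sq_nonneg (y - z), h, hy, hz, sq_nonneg (x - (y + z) / 2)]

/-- **From partition functions to ground energies** (the `β → ∞` step): `Z_β(A) ≤ Z_β(B)` for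
all `β > 0` gives `E₀(B) ≤ E₀(A)`. [cite: Lieb1994, Remark (iii)] [cite: Koma2022, (2.13)] -/
theorem groundEnergy_le_of_forall_partitionFn_le {m : Type*} [Fintype m] [DecidableEq m] [Nonempty m]
    {A B : Matrix m m ℂ} (hA : A.IsHermitian) (hB : B.IsHermitian)
    (hZ : ∀ β : ℝ, 0 < β → (A.partitionFn β).re ≤ (B.partitionFn β).re) :
    B.groundEnergy ≤ A.groundEnergy := by
  by_contra hlt
  rw [not_le] at hlt
  set δ : ℝ := B.groundEnergy - A.groundEnergy with hδ
  have hδpos : 0 < δ := by rw [hδ]; linarith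
  have hlogD : 0 ≤ Real.log (Fintype.card m) :=
    Real.log_nonneg (by exact_mod_cast Fintype.card_pos)
  set β : ℝ := (Real.log (Fintype.card m) + 1) / δ with hβdef
  have hβ : 0 < β := div_pos (by linarith) hδpos
  have key := groundEnergy_le_of_partitionFn_le hA hB hβ (hZ β hβ)
  have h1 : δ ≤ Real.log (Fintype.card m) / β := by rw [hδ]; linarith
  have h2 : Real.log (Fintype.card m) / β < δ := by
    rw [hβdef, div_div_eq_mul_div, div_lt_iff₀ (by linarith : 0 < Real.log (Fintype.card m) + 1)]
    nlinarith
  linarith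

/-- **Gaussian domination (Koma 2022, Theorem 5.3, (5.100)), in Lieb's reflection frame.** On the
even torus `(ℤ/Lℤ)^{d+1}`, `L ≥ 4`, for the `π`-flux BCS model `H(T_π(κ), U; g, h; B)` with `κ ≥ 0`,
`g ≥ 0`, any real `U`, pairing source `B`, inverse temperature `β > 0`, and ANY real field `h` on the
ordered bonds: `Tr exp[-βH(B, h)] ≤ Tr exp[-βH(B, 0)]`. Proof as printed: the reflection-positivity
inequality (5.99) at the plane `P ⊥ e₀` (`partitionFn_sq_le`), the lattice-shift and
direction-interchange gauge symmetries of §4 (`partitionFn_translate`, `partitionFn_rotateAxes`),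
and the descent of [DLS1978, Thm. 4.2] (`gaussianDomination_descent`).
[cite: Koma2022, Thm. 5.3 (5.100)] [cite: DLS1978, Thm. 4.2] -/
theorem partitionFn_le (hL : Even L) (h4 : 4 ≤ L) {β : ℝ} (hβ : 0 < β) {κ : ℝ} (hκ : 0 ≤ κ) (U : ℝ)
    {g : ℝ} (hg : 0 ≤ g) (h : FermionTorus (d + 1) L → FermionTorus (d + 1) L → ℝ) (B : ℝ) :
    ((hamiltonian κ U g h B).partitionFn β).re ≤
      ((hamiltonian κ U g (fun (_ _ : FermionTorus (d + 1) L) => (0 : ℝ)) B).partitionFn β).re := by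
  have h2 : 2 ≤ L := by omega
  set E : (FermionTorus (d + 1) L → FermionTorus (d + 1) L → ℝ) → ℝ :=
    fun h' => -((hamiltonian κ U g h' B).partitionFn β).re with hE
  have hRP : ∀ h', (E (fieldLL h') + E (fieldRR h')) / 2 ≤ E h' := fun h' => by
    have hsq := partitionFn_sq_le hL h4 hβ.le hκ U hg h' B
    have hyL : 0 ≤ ((hamiltonian κ U g (fieldLL h') B).partitionFn β).re :=
      (partitionFn_hamiltonian_re_pos (piFluxAmpl κ) (piFluxAmpl_herm κ) U g (fieldLL h') B β).le
    have hyR : 0 ≤ ((hamiltonian κ U g (fieldRR h') B).partitionFn β).re :=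
      (partitionFn_hamiltonian_re_pos (piFluxAmpl κ) (piFluxAmpl_herm κ) U g (fieldRR h') B β).le
    have := le_half_add_of_sq_le_mul' hyL hyR hsq
    simp only [hE]
    linarith
  have h0 : ∀ h' : FermionTorus (d + 1) L → FermionTorus (d + 1) L → ℝ,
      (∀ x y, (G d L).Adj x y → h' x y = 0) → E h' = E (fun _ _ => 0) := fun h' hh => by
    simp only [hE]
    rw [show hamiltonian κ U g h' B = hamiltonian κ U g (fun (_ _ : FermionTorus (d + 1) L) => (0 : ℝ)) B by
      unfold hamiltonian PairHopRP.hamiltonian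
      rw [pairInteraction_congr (G d L) hh]]
  have hτ : ∀ h', E (fun a b => h' (shiftEquiv 0 a) (shiftEquiv 0 b)) = E h' := fun h' => by
    simp only [hE]
    rw [partitionFn_translate hL h2]
  have hρ : ∀ h', E (fun a b => h' (rotateAxes a) (rotateAxes b)) = E h' := fun h' => by
    simp only [hE]
    rw [partitionFn_rotateAxes hL h2]
  have key := gaussianDomination_descent hL h4 E hRP h0 (exists_symmetry_to_cut E hL h2 hτ hρ) h
  simp only [hE] at key
  linarith

/-- **The ground-state form of Theorem 5.3**: `E₀(H(B, 0)) ≤ E₀(H(B, h))` for every real bond field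
`h` (ground-state energies over all of Fock space; `β → ∞` in (5.100)).
[cite: Koma2022, Thm. 5.3 and (2.13)] [cite: DLS1978, Thm. 4.2] -/
theorem groundEnergy_le (hL : Even L) (h4 : 4 ≤ L) {κ : ℝ} (hκ : 0 ≤ κ) (U : ℝ) {g : ℝ} (hg : 0 ≤ g)
    (h : FermionTorus (d + 1) L → FermionTorus (d + 1) L → ℝ) (B : ℝ) :
    (hamiltonian κ U g (fun (_ _ : FermionTorus (d + 1) L) => (0 : ℝ)) B).groundEnergy ≤
      (hamiltonian κ U g h B).groundEnergy :=
  haveI : Nonempty (Finset (Orb (FermionTorus (d + 1) L))) := ⟨∅⟩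
  groundEnergy_le_of_forall_partitionFn_le
    (hamiltonian_isHermitian (G d L) (piFluxAmpl κ) (piFluxAmpl_herm κ) U g h B)
    (hamiltonian_isHermitian (G d L) (piFluxAmpl κ) (piFluxAmpl_herm κ) U g
      (fun (_ _ : FermionTorus (d + 1) L) => (0 : ℝ)) B)
    (fun _ hβ => partitionFn_le hL h4 hβ hκ U hg h B)

end Main

end KomaPiFlux

end Literature.MathematicalPhysics.QuantumLattice

end
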